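import Mathlib.Data.Fintype.Pi
import Mathlib.Data.Fin.Tuple.Basic
import Mathlib.Algebra.BigOperators.Group.Finset.Basic
import Literature.Computability.QuantumComplexity.IQPForrelation

/-!
# Crux `CubicForrelation.NearExactIsExact` (stmt-QuantumAdvantage-14043) — MAXIMAL SYMPLECTIC FRAMES of an alternating form over `𝔽₂`

Certificate seat `b2b-cforr-cert` (gen 40).  HONEST FRAMING: kernel-checked folklore (standard axioms; Gram–Schmidt for alternating forms in
characteristic two, in the tree's bit-vector language).  It is tool T5 of the Lean roadmap for `E1280-even`
(HOME/b2b-cforr-cert-g40/LEAN-PLAN-E1280-EVEN.md §3): the Kasami–Tokura class of a light cell (`t̄ = z ∧ B`, …CubicFormHyperplane) and the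
Dickson-type cell lemmas are statements about a maximal symplectic frame of the alternating form `B` — the input format of
`tdq_frame_card` (…TwelveDigitProfile) and `tow_R4_frame`.  Nothing about `θ₁₂`; NOT summit progress.

* `tcs_frame_exists`: every symmetric form `B` on bit vectors with `B(x,x) = 0` admits a frame `(bᵢ, cᵢ)_{i<h}` with `B(bᵢ,cⱼ) = [i = j]`,
  `B(bᵢ,bⱼ) = B(cᵢ,cⱼ) = 0`, which is MAXIMAL: `B` vanishes identically on the set of vectors `B`-orthogonal to the frame (for the
  alternating form of a quadratic this set is a subspace — the radical plus nothing — and `h = rank/2`).  Proof: greedy extension; the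
  orthogonal set strictly shrinks at each step.

References: L. E. Dickson (1901); F. J. MacWilliams, N. J. A. Sloane (1977) Ch. 15 §2 Thm 4.  Axioms: the standard three.
-/

set_option linter.dupNamespace false -- D-0017: single-problem summit ⇒ `QuantumAdvantage.QuantumAdvantage` by design

namespace Summit.QuantumAdvantage.QuantumAdvantage.Theorems.CubicForrelation.NearExactIsExact

open Finset
open Literature.Computability.QuantumComplexity.BuzetChailloux (bxor zeroVec)

variable {n : ℕ}

/-- **Maximal symplectic frames exist.**  Let `B` be a symmetric `Bool`-valued form on `𝔽₂ⁿ` with `B(x,x) = 0`.  Then there are `h` and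
vectors `b₀,…,b_{h−1}, c₀,…,c_{h−1}` with `B(bᵢ,cᵢ) = 1`, `B(bᵢ,cⱼ) = 0 (i ≠ j)`, `B(bᵢ,bⱼ) = B(cᵢ,cⱼ) = 0`, such that `B(x,y) = 0` for all
`x, y` that are `B`-orthogonal to every frame vector. [folklore; cite: MacWilliamsSloane1977, Ch. 15 §2] -/
theorem tcs_frame_exists (B : (Fin n → Bool) → (Fin n → Bool) → Bool) (hsymm : ∀ x y, B x y = B y x) (halt : ∀ x, B x x = false) :
    ∃ (h : ℕ) (b c : Fin h → (Fin n → Bool)),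
      (∀ i, B (b i) (c i) = true) ∧ (∀ i j, i ≠ j → B (b i) (c j) = false) ∧
      (∀ i j, B (b i) (b j) = false) ∧ (∀ i j, B (c i) (c j) = false) ∧
      (∀ x y, (∀ i, B x (b i) = false) → (∀ i, B x (c i) = false) → (∀ i, B y (b i) = false) → (∀ i, B y (c i) = false) →
        B x y = false) := by
  classical
  -- the frame conditions and the orthogonal set
  let Frame : (k : ℕ) → (Fin k → (Fin n → Bool)) → (Fin k → (Fin n → Bool)) → Prop := fun k b c =>
    (∀ i, B (b i) (c i) = true) ∧ (∀ i j, i ≠ j → B (b i) (c j) = false) ∧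
      (∀ i j, B (b i) (b j) = false) ∧ (∀ i j, B (c i) (c j) = false)
  let O : (k : ℕ) → (Fin k → (Fin n → Bool)) → (Fin k → (Fin n → Bool)) → Finset (Fin n → Bool) := fun k b c =>
    univ.filter fun x => (∀ i, B x (b i) = false) ∧ (∀ i, B x (c i) = false)
  -- greedy extension, by induction on the size of the orthogonal set
  have main : ∀ (m k : ℕ) (b c : Fin k → (Fin n → Bool)), Frame k b c → #(O k b c) ≤ m →
      ∃ (h : ℕ) (b' c' : Fin h → (Fin n → Bool)), Frame h b' c' ∧ ∀ x y, x ∈ O h b' c' → y ∈ O h b' c' → B x y = false := by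
    intro m
    induction m with
    | zero =>
      intro k b c hF hO
      refine ⟨k, b, c, hF, fun x y hx _ => ?_⟩
      have : #(O k b c) = 0 := Nat.le_zero.mp hO
      rw [card_eq_zero] at this
      rw [this] at hx
      exact absurd hx (notMem_empty x)
    | succ m ih =>
      intro k b c hF hO
      by_cases hex : ∃ x y, x ∈ O k b c ∧ y ∈ O k b c ∧ B x y = true
      · obtain ⟨x, y, hx, hy, hxy⟩ := hex
        obtain ⟨hxb, hxc⟩ := (mem_filter.1 hx).2
        obtain ⟨hyb, hyc⟩ := (mem_filter.1 hy).2
        obtain ⟨hF1, hF2, hF3, hF4⟩ := hF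
        -- the extended frame
        have hF' : Frame (k + 1) (Fin.snoc b x) (Fin.snoc c y) := by
          refine ⟨fun i => ?_, fun i j hij => ?_, fun i j => ?_, fun i j => ?_⟩
          · rcases Fin.eq_castSucc_or_eq_last i with ⟨i', rfl⟩ | rfl
            · simp only [Fin.snoc_castSucc]; exact hF1 i'
            · simp only [Fin.snoc_last]; exact hxy
          · rcases Fin.eq_castSucc_or_eq_last i with ⟨i', rfl⟩ | rfl <;>
              rcases Fin.eq_castSucc_or_eq_last j with ⟨j', rfl⟩ | rfl
            · simp only [Fin.snoc_castSucc]
              exact hF2 i' j' fun h => hij (by rw [h])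
            · simp only [Fin.snoc_castSucc, Fin.snoc_last]
              rw [hsymm]; exact hyb i'
            · simp only [Fin.snoc_castSucc, Fin.snoc_last]
              exact hxc j'
            · exact absurd rfl hij
          · rcases Fin.eq_castSucc_or_eq_last i with ⟨i', rfl⟩ | rfl <;>
              rcases Fin.eq_castSucc_or_eq_last j with ⟨j', rfl⟩ | rfl
            · simp only [Fin.snoc_castSucc]; exact hF3 i' j'
            · simp only [Fin.snoc_castSucc, Fin.snoc_last]
              rw [hsymm]; exact hxb i'
            · simp only [Fin.snoc_castSucc, Fin.snoc_last]; exact hxb j'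
            · simp only [Fin.snoc_last]; exact halt x
          · rcases Fin.eq_castSucc_or_eq_last i with ⟨i', rfl⟩ | rfl <;>
              rcases Fin.eq_castSucc_or_eq_last j with ⟨j', rfl⟩ | rfl
            · simp only [Fin.snoc_castSucc]; exact hF4 i' j'
            · simp only [Fin.snoc_castSucc, Fin.snoc_last]
              rw [hsymm]; exact hyc i'
            · simp only [Fin.snoc_castSucc, Fin.snoc_last]; exact hyc j'
            · simp only [Fin.snoc_last]; exact halt y
        -- the orthogonal set shrinks strictly: it is contained in the old one and loses `x`
        have hsub : O (k + 1) (Fin.snoc b x) (Fin.snoc c y) ⊆ O k b c := by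
          intro z hz
          obtain ⟨hzb, hzc⟩ := (mem_filter.1 hz).2
          refine mem_filter.2 ⟨mem_univ _, fun i => ?_, fun i => ?_⟩
          · have := hzb (Fin.castSucc i); simpa only [Fin.snoc_castSucc] using this
          · have := hzc (Fin.castSucc i); simpa only [Fin.snoc_castSucc] using this
        have hxnot : x ∉ O (k + 1) (Fin.snoc b x) (Fin.snoc c y) := by
          intro hx'
          have := ((mem_filter.1 hx').2).2 (Fin.last k)
          simp only [Fin.snoc_last] at this
          rw [this] at hxy
          exact Bool.false_ne_true hxy
        have hlt : #(O (k + 1) (Fin.snoc b x) (Fin.snoc c y)) < #(O k b c) :=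
          card_lt_card ⟨hsub, fun hsup => hxnot (hsup hx)⟩
        exact ih (k + 1) (Fin.snoc b x) (Fin.snoc c y) hF' (by omega)
      · -- no pair left: the frame is maximal
        push Not at hex
        refine ⟨k, b, c, hF, fun x y hx hy => ?_⟩
        have := hex x y hx hy
        simpa using this
  -- start from the empty frame
  have hF0 : Frame 0 (fun i => Fin.elim0 i) (fun i => Fin.elim0 i) :=
    ⟨fun i => Fin.elim0 i, fun i => Fin.elim0 i, fun i => Fin.elim0 i, fun i => Fin.elim0 i⟩
  obtain ⟨h, b', c', ⟨hF1, hF2, hF3, hF4⟩, hmax⟩ := main _ 0 _ _ hF0 le_rfl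
  refine ⟨h, b', c', hF1, hF2, hF3, hF4, fun x y hxb hxc hyb hyc => hmax x y ?_ ?_⟩
  · exact mem_filter.2 ⟨mem_univ _, hxb, hxc⟩
  · exact mem_filter.2 ⟨mem_univ _, hyb, hyc⟩

end Summit.QuantumAdvantage.QuantumAdvantage.Theorems.CubicForrelation.NearExactIsExact
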